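import Literature.NumberTheory.PAdicHodge.AinfRamifiedTateModule
import Literature.NumberTheory.PAdicHodge.AinfRamifiedTopology
import Literature.NumberTheory.PAdicHodge.AinfTopology
import Literature.NumberTheory.PAdicHodge.CompletedAlgClosureAlgClosed
import Literature.NumberTheory.PAdicHodge.AinfWeierstrassTateModuleSupersingular
import Literature.NumberTheory.EllipticCurves.FormalGroupMultiplicationUniversalProofs
import Mathlib.RingTheory.PowerSeries.WeierstrassPreparation
import HarnessLib

/-!
# `[p]` is SURJECTIVE on `Ŵ(𝔪_{ℂ_F})` at height one: roots of Weierstrass-regular power series over `𝒪_{ℂ_F}`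

Topic `Literature/NumberTheory/PAdicHodge`; namespace `Literature.NumberTheory.PAdicHodge`. THEOREMS ONLY (no definition, no named fact, no
instance, no `sorry`). Brick B5 of the ORDINARY (height-one) frame for Kato's explicit reciprocity law on the (G)-ordinary K★ cells (memo
`Summits/BirchSwinnertonDyer/BirchSwinnertonDyer/Cruxes/StarredOptimalManinUnitFiveSeven/Lines/kato-lever-seam-rec-at-cells.md` §17): the Kummer
integral of a formal point `P` of the good ordinary model needs a `[p]`-DIVISION TOWER `u` of `z(P)` in `Ŵ(𝔪_{ℂ_F})` (`AinfRamifiedDivisionLift`);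
at supersingular reduction all algebraic division points are formal (`exists_divSeq_mem_kernel`), at ordinary reduction they are not, and the tower is
built instead by `p`-DIVISION INSIDE THE FORMAL GROUP:

* §1 `isAdicComplete_span_natCast_cBall`, `isAdicComplete_span_cBall_of_norm_le` — `𝒪_{ℂ_F}` is `(a)`-adically complete for every `a` with
  `‖p‖ ≤ ‖a‖ < 1` (transfer along `integerC ≃ CBall` and `AinfRam.isAdicComplete_of_ge_of_pow_le`).
* §2 ★★ `exists_aeval_eq_zero_of_coeff_mem_of_isUnit` — **a power series `G ∈ 𝒪_{ℂ_F}⟦X⟧` with `[Xⁱ]G ∈ I` (`i < n`, `n ≥ 1`) and `[Xⁿ]G` a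
  unit, `I` an ideal of topologically nilpotent elements for which `𝒪_{ℂ_F}` is `I`-adically complete, has a ROOT in `𝔪_{ℂ_F}`**: Mathlib's
  Weierstrass division at `I` (`PowerSeries.IsWeierstrassDivisorAt.isWeierstrassDivisionAt_div_mod`) writes `Xⁿ = G·q + r`, `deg r < n`,
  `r ≡ 0 (mod I)`, `q(0)` a unit; the distinguished polynomial `Xⁿ − r` has a root `x ∈ ℂ_F` (algebraically closed), necessarily with `‖x‖ < 1`
  (ultrametric), and evaluating (`PowerSeries.aeval`) gives `G(x)·q(x) = 0` with `q(x)` a unit.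
* §3 ★★ `exists_aeval_formalMul_prime_eq` — **`[p]_W : Ŵ(𝔪_{ℂ_F}) → Ŵ(𝔪_{ℂ_F})` is onto when `[Xᵖ][p]_W ∈ 𝒪_{ℂ_F}ˣ`** (height one = ORDINARY
  reduction: `[Xᵖ][p] ≡ A_p`, `coeff_prime_formalMul_sub_hasseCoeff_mem_span`), for `W` over `𝒪_{ℂ_F}`, `p ≠ 2`: by AEC IV.4.4
  `[p] = p·f + g(Xᵖ)` the series `G = [p] − t` is Weierstrass-regular of order `p` at `I = (p)` (`t ∈ p𝒪`) or `I = (t)` (`‖p‖ ≤ ‖t‖`).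

BSD / K★ (`stmt-BirchSwinnertonDyer-22226`) are NOT proved by any of this; nothing about elliptic curves over number fields is proved here.

## References
* J. H. Silverman, *The Arithmetic of Elliptic Curves* (2009), IV.2.3, IV.3.2, IV.4.4, IV.7 (height). [SilvermanAEC2009]
* L. C. Washington, *Introduction to Cyclotomic Fields* (1997), Prop. 7.2, Thm. 7.3 (Weierstrass division / preparation). [Washington1997]
* J. Lubin, J. Tate, *Formal complex multiplication in local fields*, Ann. of Math. 81 (1965), §1 (division points over `𝒪_{F̄}`). [LubinTate1965]
-/

noncomputable section

open scoped Classical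
open Polynomial PowerSeries Field ValuativeRel

namespace Literature.NumberTheory.PAdicHodge

open Literature.NumberTheory.GaloisRepresentations
open Literature.NumberTheory.GaloisRepresentations.IsNonarchimedeanLocalField
open Literature.NumberTheory.GaloisRepresentations.LubinTate

variable {F : Type} [Field F] [ValuativeRel F] [TopologicalSpace F] [IsNonarchimedeanLocalField F] [CharZero F]
  {p : ℕ} [Fact p.Prime] [Fact (¬ IsUnit (p : integerC F))] [IsAdicComplete (Ideal.span {(p : integerC F)}) (integerC F)]
  [CharZero (CompletedAlgClosure F)]

/-! ## §1 Adic completeness of `𝒪_{ℂ_F}` -/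

omit [CharZero F] [Fact p.Prime] [Fact (¬ IsUnit (p : integerC F))] [CharZero (CompletedAlgClosure F)] in
/-- `𝒪_{ℂ_F} = CBall F` is `p`-adically complete (transfer of the tree's instance on `integerC F` along the identity `integerC ≃ CBall`).
[cite: FontaineOuyang2022, §3.1] -/
theorem isAdicComplete_span_natCast_cBall : IsAdicComplete (Ideal.span {(p : CBall F)}) (CBall F) := by
  have h : (Ideal.span {(p : integerC F)}).map (integerCEquivCBall (F := F)) = Ideal.span {(p : CBall F)} := by
    rw [Ideal.map_span, Set.image_singleton, map_natCast]
  rw [← h]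
  exact (IsAdicComplete.congr_ringEquiv (e := integerCEquivCBall (F := F)) (I := Ideal.span {(p : integerC F)})).2 inferInstance

omit [CharZero F] [Fact p.Prime] [Fact (¬ IsUnit (p : integerC F))] [IsAdicComplete (Ideal.span {(p : integerC F)}) (integerC F)]
  [CharZero (CompletedAlgClosure F)] in
/-- In the valuation ring `𝒪_{ℂ_F}`, `‖b‖ ≤ ‖a‖` gives `a ∣ b`. [cite: SilvermanAEC2009, IV.3.2] -/
theorem dvd_of_norm_le_cBall {a b : CBall F} (ha : a ≠ 0) (h : ‖(b : CompletedAlgClosure F)‖ ≤ ‖(a : CompletedAlgClosure F)‖) : a ∣ b := by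
  have ha' : (a : CompletedAlgClosure F) ≠ 0 := fun h0 => ha (Subtype.ext h0)
  refine ⟨⟨(b : CompletedAlgClosure F) / a, ?_⟩, Subtype.ext ?_⟩
  · rw [mem_unitBall_iff, norm_div]
    exact div_le_one_of_le₀ h (norm_nonneg _)
  · change (b : CompletedAlgClosure F) = a * (b / a)
    rw [mul_div_cancel₀ _ ha']

omit [CharZero F] [Fact (¬ IsUnit (p : integerC F))] in
/-- `𝒪_{ℂ_F}` is `(a)`-adically complete whenever `‖p‖ ≤ ‖a‖ < 1` (the ideals `(p) ⊆ (a)`, `(a)^N ⊆ (p)` are commensurable).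
[cite: StacksProject, Tag 0317] -/
theorem isAdicComplete_span_cBall_of_norm_le {a : CBall F} (hpa : ‖(p : CompletedAlgClosure F)‖ ≤ ‖(a : CompletedAlgClosure F)‖)
    (ha : ‖(a : CompletedAlgClosure F)‖ < 1) : IsAdicComplete (Ideal.span {a}) (CBall F) := by
  haveI := isAdicComplete_span_natCast_cBall (F := F) (p := p)
  have hp0 : (p : CompletedAlgClosure F) ≠ 0 := Nat.cast_ne_zero.2 (Fact.out : p.Prime).ne_zero
  have hpn : 0 < ‖(p : CompletedAlgClosure F)‖ := norm_pos_iff.2 hp0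
  have ha0 : a ≠ 0 := fun h0 => by rw [h0, ZeroMemClass.coe_zero, norm_zero] at hpa; exact absurd hpa (not_le.2 hpn)
  -- `(p) ≤ (a)`
  have hle : Ideal.span {(p : CBall F)} ≤ Ideal.span {a} := by
    rw [Ideal.span_singleton_le_span_singleton]
    exact dvd_of_norm_le_cBall ha0 (by exact_mod_cast hpa)
  -- `(a)^N ≤ (p)` for `‖a‖^N ≤ ‖p‖`
  obtain ⟨N, hN⟩ : ∃ N : ℕ, ‖(a : CompletedAlgClosure F)‖ ^ N ≤ ‖(p : CompletedAlgClosure F)‖ := by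
    obtain ⟨N, hN⟩ := exists_pow_lt_of_lt_one hpn ha
    exact ⟨N, hN.le⟩
  have hN1 : 0 < N + 1 := Nat.succ_pos N
  have hp0' : (p : CBall F) ≠ 0 := fun h0 => hp0 (by
    have h1 := congrArg (fun z : CBall F => (z : CompletedAlgClosure F)) h0
    simpa using h1)
  have hpow : Ideal.span {a} ^ (N + 1) ≤ Ideal.span {(p : CBall F)} := by
    rw [Ideal.span_singleton_pow, Ideal.span_singleton_le_span_singleton]
    refine dvd_of_norm_le_cBall hp0' ?_
    rw [SubmonoidClass.coe_pow, norm_pow, pow_succ]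
    have e1 : ((p : CBall F) : CompletedAlgClosure F) = (p : CompletedAlgClosure F) := by simp
    rw [e1]
    calc ‖(a : CompletedAlgClosure F)‖ ^ N * ‖(a : CompletedAlgClosure F)‖ ≤ ‖(p : CompletedAlgClosure F)‖ * 1 :=
          mul_le_mul hN ha.le (norm_nonneg _) (norm_nonneg _)
      _ = ‖(p : CompletedAlgClosure F)‖ := mul_one _
  exact isAdicComplete_of_ge_of_pow_le hN1 hle hpow

/-! ## §2 Roots of Weierstrass-regular power series over `𝒪_{ℂ_F}` -/

omit [Fact p.Prime] [Fact (¬ IsUnit (p : integerC F))] [IsAdicComplete (Ideal.span {(p : integerC F)}) (integerC F)]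
  [CharZero (CompletedAlgClosure F)] in
set_option maxHeartbeats 1600000 in
/-- ★★ **Roots of a Weierstrass-regular series.** Let `I` be an ideal of `𝒪_{ℂ_F}` consisting of elements of norm `< 1`, for which `𝒪_{ℂ_F}` is
`I`-adically complete, and `G ∈ 𝒪_{ℂ_F}⟦X⟧` with `[Xⁱ]G ∈ I` for `i < n` (`1 ≤ n`) and `[Xⁿ]G` a unit. Then `G(x) = 0` for some `x ∈ 𝔪_{ℂ_F}`
(Weierstrass division `Xⁿ = Gq + r`; a root of the distinguished polynomial `Xⁿ − r` in the algebraically closed `ℂ_F`).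
[cite: Washington1997, Prop. 7.2 and Thm. 7.3] [cite: LubinTate1965, §1] -/
theorem exists_aeval_eq_zero_of_coeff_mem_of_isUnit {I : Ideal (CBall F)} [IsAdicComplete I (CBall F)]
    (hI : ∀ x ∈ I, ‖(x : CompletedAlgClosure F)‖ < 1) {G : (CBall F)⟦X⟧} {n : ℕ} (hn : 1 ≤ n)
    (hlow : ∀ i < n, PowerSeries.coeff i G ∈ I) (hunit : IsUnit (PowerSeries.coeff n G)) :
    ∃ x : (maxNilIdealC F).toIdeal,
      PowerSeries.aeval ((maxNilIdealC F).isTopologicallyNilpotent _ x.2) G = 0 := by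
  have hItop : I ≠ ⊤ := fun h => by
    have h1 := hI 1 (h ▸ Submodule.mem_top)
    rw [OneMemClass.coe_one, norm_one] at h1
    exact lt_irrefl _ h1
  -- the order of `G mod I` is `n`
  have hord : (G.map (Ideal.Quotient.mk I)).order = n := by
    refine PowerSeries.order_eq_nat.2 ⟨?_, fun i hi => ?_⟩
    · rw [PowerSeries.coeff_map]
      intro h0
      rw [Ideal.Quotient.eq_zero_iff_mem] at h0
      exact hItop (Ideal.eq_top_of_isUnit_mem _ h0 hunit)
    · rw [PowerSeries.coeff_map, Ideal.Quotient.eq_zero_iff_mem]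
      exact hlow i hi
  have hordn : (G.map (Ideal.Quotient.mk I)).order.toNat = n := by rw [hord]; rfl
  have H : G.IsWeierstrassDivisorAt I := by
    rw [PowerSeries.IsWeierstrassDivisorAt, hordn]; exact hunit
  -- Weierstrass division of `Xⁿ`
  obtain ⟨hdeg, heq⟩ := H.isWeierstrassDivisionAt_div_mod (PowerSeries.X ^ n)
  set q := H.div (PowerSeries.X ^ n) with hq
  set r := H.mod (PowerSeries.X ^ n) with hr
  rw [hordn] at hdeg
  have hdeg' : r.natDegree < n := by
    rcases eq_or_ne r 0 with h0 | h0
    · rw [h0, Polynomial.natDegree_zero]; omega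
    · exact (Polynomial.natDegree_lt_iff_degree_lt h0).2 hdeg
  -- `r ≡ 0 (mod I)`
  have hrI : ∀ i, r.coeff i ∈ I := by
    intro i
    by_cases hi : i < n
    · have h := (H.isWeierstrassDivisionAt_div_mod (PowerSeries.X ^ n)).coeff_f_sub_r_mem (i := i) (by rw [hordn]; exact hi)
      rw [map_sub, PowerSeries.coeff_X_pow, if_neg hi.ne, zero_sub, Polynomial.coeff_coe, neg_mem_iff] at h
      exact h
    · rw [Polynomial.coeff_eq_zero_of_natDegree_lt (lt_of_lt_of_le hdeg' (not_lt.1 hi))]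
      exact I.zero_mem
  -- `q(0)` is a unit: compare the coefficients of `Xⁿ` modulo `I`
  have hq0 : IsUnit (PowerSeries.constantCoeff q) := by
    have hcoef := congrArg (PowerSeries.coeff n) heq
    rw [PowerSeries.coeff_X_pow_self, map_add, Polynomial.coeff_coe, Polynomial.coeff_eq_zero_of_natDegree_lt hdeg', add_zero,
      PowerSeries.coeff_mul] at hcoef
    -- split off the term `(n, 0)`
    have hmem : ((n, 0) : ℕ × ℕ) ∈ Finset.HasAntidiagonal.antidiagonal n := Finset.HasAntidiagonal.mem_antidiagonal.2 (add_zero n)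
    rw [← Finset.add_sum_erase _ _ hmem, PowerSeries.coeff_zero_eq_constantCoeff] at hcoef
    have hrest : ∑ x ∈ (Finset.HasAntidiagonal.antidiagonal n).erase (n, 0), PowerSeries.coeff x.1 G * PowerSeries.coeff x.2 q ∈ I := by
      refine I.sum_mem fun x hx => ?_
      obtain ⟨hx2, hx1⟩ := Finset.mem_erase.1 hx
      have hsum := Finset.HasAntidiagonal.mem_antidiagonal.1 hx1
      have hlt : x.1 < n := by
        rcases lt_or_eq_of_le (Nat.le.intro hsum) with h | h
        · exact h
        · exfalso; refine hx2 ?_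
          ext
          · exact h
          · simpa [h] using hsum
      exact I.mul_mem_right _ (hlow _ hlt)
    -- `G_n q_0 = 1 - (element of I)` is a unit (`I ⊆ 𝔪`, `𝒪_{ℂ_F}` local by the norm)
    have hGq : IsUnit (PowerSeries.coeff n G * PowerSeries.constantCoeff q) := by
      have e1 : PowerSeries.coeff n G * PowerSeries.constantCoeff q =
          1 - ∑ x ∈ (Finset.HasAntidiagonal.antidiagonal n).erase (n, 0), PowerSeries.coeff x.1 G * PowerSeries.coeff x.2 q := by
        dsimp only at hcoef
        linear_combination -hcoef
      rw [e1, AinfTop.isUnit_unitBall_iff, AddSubgroupClass.coe_sub, OneMemClass.coe_one]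
      have hlt1 := hI _ hrest
      rw [sub_eq_add_neg, IsUltrametricDist.norm_add_eq_max_of_norm_ne_norm (by rw [norm_one, norm_neg]; exact (ne_of_lt hlt1).symm),
        norm_one, norm_neg, max_eq_left hlt1.le]
    exact isUnit_of_mul_isUnit_right hGq
  -- a root of the distinguished polynomial `Xⁿ − r` in `ℂ_F`
  haveI : IsAlgClosed (CompletedAlgClosure F) := CompletedAlgClosure.isAlgClosed (F := F)
  set P : (CBall F)[X] := Polynomial.X ^ n - r with hP
  have hPmonic : P.Monic := Polynomial.Monic.sub_of_left (Polynomial.monic_X_pow n) (by rwa [Polynomial.degree_X_pow])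
  have hPnat : P.natDegree = n := by
    rw [hP, Polynomial.natDegree_sub_eq_left_of_natDegree_lt (by rwa [Polynomial.natDegree_X_pow]), Polynomial.natDegree_X_pow]
  have hPdeg : (P.map (algebraMap (CBall F) (CompletedAlgClosure F))).degree ≠ 0 := by
    rw [Polynomial.degree_eq_natDegree (hPmonic.map _).ne_zero, hPmonic.natDegree_map, hPnat]
    exact_mod_cast (show n ≠ 0 by omega)
  obtain ⟨x, hx⟩ := IsAlgClosed.exists_root _ hPdeg
  have haev : Polynomial.aeval x P = 0 := by rw [Polynomial.aeval_def, ← Polynomial.eval_map]; exact hx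
  -- `x^n = -Σ_{i<n} φ(P_i) x^i`, hence `‖x‖ < 1`
  have heval : x ^ n = -∑ i ∈ Finset.range n, algebraMap (CBall F) (CompletedAlgClosure F) (P.coeff i) * x ^ i := by
    have h := haev
    rw [Polynomial.aeval_eq_sum_range, hPnat, Finset.sum_range_succ, ← hPnat, hPmonic.coeff_natDegree, one_smul, hPnat] at h
    simp_rw [Algebra.smul_def] at h
    linear_combination h
  have hxlt : ‖x‖ < 1 := by
    by_contra hge
    rw [not_lt] at hge
    have hne : (Finset.range n).Nonempty := Finset.nonempty_range_iff.2 (by omega)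
    obtain ⟨i, hi, hle⟩ := IsUltrametricDist.exists_norm_finsetSum_le_of_nonempty hne
      (fun i => algebraMap (CBall F) (CompletedAlgClosure F) (P.coeff i) * x ^ i)
    have hi' : i < n := Finset.mem_range.1 hi
    have hterm : ‖algebraMap (CBall F) (CompletedAlgClosure F) (P.coeff i) * x ^ i‖ < ‖x‖ ^ n := by
      rw [norm_mul, norm_pow]
      have hcoef : ‖algebraMap (CBall F) (CompletedAlgClosure F) (P.coeff i)‖ < 1 := by
        rw [hP, Polynomial.coeff_sub, Polynomial.coeff_X_pow, if_neg hi'.ne, zero_sub, map_neg, norm_neg]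
        exact hI _ (hrI i)
      calc ‖algebraMap (CBall F) (CompletedAlgClosure F) (P.coeff i)‖ * ‖x‖ ^ i < 1 * ‖x‖ ^ i :=
            mul_lt_mul_of_pos_right hcoef (pow_pos (lt_of_lt_of_le one_pos hge) i)
        _ ≤ ‖x‖ ^ n := by rw [one_mul]; exact pow_le_pow_right₀ hge hi'.le
    have hxn : ‖x‖ ^ n = ‖∑ i ∈ Finset.range n, algebraMap (CBall F) (CompletedAlgClosure F) (P.coeff i) * x ^ i‖ := by
      rw [← norm_pow, heval, norm_neg]
    exact lt_irrefl _ (lt_of_le_of_lt (hxn.le.trans hle) hterm)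
  -- the root as a point of `𝔪_{ℂ_F}`
  set xO : CBall F := ⟨x, (mem_unitBall_iff _).2 hxlt.le⟩ with hxO
  have hxM : xO ∈ (maxNilIdealC F).toIdeal := by change ‖x‖ < 1; exact hxlt
  refine ⟨⟨xO, hxM⟩, ?_⟩
  -- evaluate `Xⁿ = G q + r` at `x`
  have hPx : P.eval xO = 0 := by
    have h := Polynomial.aeval_algebraMap_apply_eq_algebraMap_eval (A := CompletedAlgClosure F) xO P
    rw [show algebraMap (CBall F) (CompletedAlgClosure F) xO = x from rfl, haev] at h
    exact Subtype.ext h.symm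
  have hrx : Polynomial.aeval xO r = xO ^ n := by
    rw [Polynomial.coe_aeval_eq_eval]
    have h2 : P.eval xO = xO ^ n - r.eval xO := by rw [hP, Polynomial.eval_sub, Polynomial.eval_pow, Polynomial.eval_X]
    rw [h2, sub_eq_zero] at hPx
    exact hPx.symm
  have hev := congrArg (PowerSeries.aeval ((maxNilIdealC F).isTopologicallyNilpotent _ hxM)) heq
  have hX : PowerSeries.aeval ((maxNilIdealC F).isTopologicallyNilpotent _ hxM) (PowerSeries.X : (CBall F)⟦X⟧) = xO := by
    rw [PowerSeries.coe_aeval, PowerSeries.eval₂_X]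
  rw [map_pow, hX, map_add, map_mul, PowerSeries.aeval_coe, hrx] at hev
  -- `G(x) q(x) = 0` with `q(x)` a unit
  have hqx : IsUnit (PowerSeries.aeval ((maxNilIdealC F).isTopologicallyNilpotent _ hxM) q) :=
    (PowerSeries.isUnit_iff_constantCoeff.2 hq0).map _
  have h0 : PowerSeries.aeval ((maxNilIdealC F).isTopologicallyNilpotent _ hxM) G *
      PowerSeries.aeval ((maxNilIdealC F).isTopologicallyNilpotent _ hxM) q = 0 := by
    linear_combination -hev
  exact hqx.mul_left_eq_zero.1 h0

/-! ## §3 `[p]` is onto `Ŵ(𝔪_{ℂ_F})` at height one -/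

omit [Fact (¬ IsUnit (p : integerC F))] in
set_option maxHeartbeats 1600000 in
/-- ★★ **Division by `[p]` in the formal group over `𝒪_{ℂ_F}` at height one.** Let `W` be a Weierstrass equation over `𝒪_{ℂ_F}` whose
multiplication-by-`p` series has a UNIT coefficient at `Xᵖ` (`[Xᵖ][p] ≡ A_p (mod p)`: ordinary reduction), `p ≠ 2`... (only `[p] = p·f + g(Xᵖ)`
is used). Then every `t ∈ 𝔪_{ℂ_F}` is `[p](s)` for some `s ∈ 𝔪_{ℂ_F}` (as `PowerSeries.aeval`, i.e. `evalPt₁`). So `[p]`-division TOWERS exist above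
every point of `Ŵ(𝔪_{ℂ_F})`. [cite: SilvermanAEC2009, IV.4.4 and IV.7] [cite: LubinTate1965, §1] -/
theorem exists_aeval_formalMul_prime_eq (hpC : ‖(p : CompletedAlgClosure F)‖ < 1) (W : WeierstrassCurve (CBall F))
    (h1 : IsUnit (PowerSeries.coeff p (W.formalMul p))) (t : (maxNilIdealC F).toIdeal) :
    ∃ s : (maxNilIdealC F).toIdeal,
      PowerSeries.aeval ((maxNilIdealC F).isTopologicallyNilpotent _ s.2) (W.formalMul p) = (t : CBall F) := by
  have hp : p.Prime := Fact.out
  have ht1 : ‖((t : CBall F) : CompletedAlgClosure F)‖ < 1 := t.2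
  -- the series `G = [p] − t` and its low coefficients
  set G : (CBall F)⟦X⟧ := W.formalMul p - PowerSeries.C (t : CBall F) with hG
  have hcoef0 : PowerSeries.coeff 0 G = -(t : CBall F) := by
    rw [hG, map_sub, PowerSeries.coeff_C, if_pos rfl, PowerSeries.coeff_zero_eq_constantCoeff, W.constantCoeff_formalMul, zero_sub]
  have hcoefi : ∀ i, 0 < i → ¬ p ∣ i → PowerSeries.coeff i G = (p : CBall F) * PowerSeries.coeff i (W.formalMulPPart p) := by
    intro i hi hpi
    rw [hG, map_sub, PowerSeries.coeff_C, if_neg hi.ne', sub_zero, W.formalMul_prime_eq_add_expand p, map_add,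
      ← map_natCast (PowerSeries.C (R := CBall F)) p, PowerSeries.coeff_C_mul, PowerSeries.coeff_expand, if_neg hpi, add_zero]
  have hcoefp : PowerSeries.coeff p G = PowerSeries.coeff p (W.formalMul p) := by
    rw [hG, map_sub, PowerSeries.coeff_C, if_neg hp.ne_zero, sub_zero]
  -- the ideal `I = (p)` or `(t)`
  have key : ∀ (I : Ideal (CBall F)) [IsAdicComplete I (CBall F)], (∀ x ∈ I, ‖(x : CompletedAlgClosure F)‖ < 1) →
      (t : CBall F) ∈ I → (p : CBall F) ∈ I →
      ∃ s : (maxNilIdealC F).toIdeal, PowerSeries.aeval ((maxNilIdealC F).isTopologicallyNilpotent _ s.2) (W.formalMul p) = (t : CBall F) := by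
    intro I _ hI htI hpI
    have hlow : ∀ i < p, PowerSeries.coeff i G ∈ I := by
      intro i hi
      rcases Nat.eq_zero_or_pos i with h0 | hpos
      · rw [h0, hcoef0]; exact I.neg_mem htI
      · rw [hcoefi i hpos (fun hdvd => absurd (Nat.le_of_dvd hpos hdvd) (not_le.2 hi))]
        exact I.mul_mem_right _ hpI
    obtain ⟨s, hs⟩ := exists_aeval_eq_zero_of_coeff_mem_of_isUnit (I := I) hI hp.one_lt.le hlow (by rwa [hcoefp])
    refine ⟨s, ?_⟩
    rw [hG, map_sub, sub_eq_zero, ← Polynomial.coe_C, PowerSeries.aeval_coe, Polynomial.aeval_C] at hs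
    exact hs
  by_cases hle : ‖((t : CBall F) : CompletedAlgClosure F)‖ ≤ ‖(p : CompletedAlgClosure F)‖
  · -- `I = (p)`
    haveI := isAdicComplete_span_natCast_cBall (F := F) (p := p)
    have hp0' : (p : CBall F) ≠ 0 := fun h0 => (Nat.cast_ne_zero.2 hp.ne_zero : (p : CompletedAlgClosure F) ≠ 0) (by
      have h1 := congrArg (fun z : CBall F => (z : CompletedAlgClosure F)) h0; simpa using h1)
    refine key (Ideal.span {(p : CBall F)}) (fun x hx => ?_) ?_ (Ideal.subset_span rfl)
    · obtain ⟨c, rfl⟩ := Ideal.mem_span_singleton'.1 hx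
      rw [Subring.coe_mul, norm_mul]
      have e1 : ((p : CBall F) : CompletedAlgClosure F) = (p : CompletedAlgClosure F) := by simp
      rw [e1]
      calc ‖(c : CompletedAlgClosure F)‖ * ‖(p : CompletedAlgClosure F)‖ ≤ 1 * ‖(p : CompletedAlgClosure F)‖ :=
            mul_le_mul_of_nonneg_right ((mem_unitBall_iff _).1 c.2) (norm_nonneg _)
        _ < 1 := by rw [one_mul]; exact hpC
    · exact Ideal.mem_span_singleton.2 (dvd_of_norm_le_cBall hp0' (by simpa using hle))
  · -- `I = (t)`
    rw [not_le] at hle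
    haveI := isAdicComplete_span_cBall_of_norm_le (F := F) (p := p) hle.le ht1
    have ht0 : (t : CBall F) ≠ 0 := fun h0 => by
      rw [h0, ZeroMemClass.coe_zero, norm_zero] at hle; exact absurd hle (not_lt.2 (norm_nonneg _))
    refine key (Ideal.span {(t : CBall F)}) (fun x hx => ?_) (Ideal.subset_span rfl) ?_
    · obtain ⟨c, rfl⟩ := Ideal.mem_span_singleton'.1 hx
      rw [Subring.coe_mul, norm_mul]
      calc ‖(c : CompletedAlgClosure F)‖ * ‖((t : CBall F) : CompletedAlgClosure F)‖ ≤ 1 * ‖((t : CBall F) : CompletedAlgClosure F)‖ :=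
            mul_le_mul_of_nonneg_right ((mem_unitBall_iff _).1 c.2) (norm_nonneg _)
        _ < 1 := by rw [one_mul]; exact ht1
    · refine Ideal.mem_span_singleton.2 (dvd_of_norm_le_cBall ht0 ?_)
      simpa using hle.le

omit [CharZero F] [Fact p.Prime] [Fact (¬ IsUnit (p : integerC F))] [IsAdicComplete (Ideal.span {(p : integerC F)}) (integerC F)]
  [CharZero (CompletedAlgClosure F)] in
/-- **Change of coefficients**: evaluating `φ_* h` (`φ : A → 𝒪_{ℂ_F}` the structure map) by `PowerSeries.aeval` over `𝒪_{ℂ_F}` is the tree's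
`evalPt₁` of `h` (both are `Σ hₙ xⁿ`). [cite: CasselsFrohlichANT1967, Ch. VI §3.2] -/
theorem aeval_map_algebraMap_eq_evalPt₁ {A : Type*} [CommRing A] [UniformSpace A] [DiscreteUniformity A] [Algebra A (CBall F)]
    [ContinuousSMul A (CBall F)] (h : PowerSeries A) (hh : PowerSeries.constantCoeff h = 0) (x : (maxNilIdealC F).toIdeal) :
    PowerSeries.aeval ((maxNilIdealC F).isTopologicallyNilpotent _ x.2) (h.map (algebraMap A (CBall F))) =
      (evalPt₁ (maxNilIdealC F) h hh x : CBall F) := by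
  rw [coe_evalPt₁]
  have h1 := PowerSeries.hasSum_aeval ((maxNilIdealC F).isTopologicallyNilpotent _ x.2) (h.map (algebraMap A (CBall F)))
  have h2 := PowerSeries.hasSum_aeval ((maxNilIdealC F).isTopologicallyNilpotent _ x.2) h
  simp_rw [PowerSeries.coeff_map, smul_eq_mul] at h1
  simp_rw [Algebra.smul_def] at h2
  exact h1.unique h2

omit [Fact (¬ IsUnit (p : integerC F))] in
/-- ★ **The `evalPt₁` form, coefficients in a discrete ring `A → 𝒪_{ℂ_F}`**: if `[Xᵖ][p]_W` maps to a unit of `𝒪_{ℂ_F}` then `[p]_W(s) = t` has a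
solution `s ∈ 𝔪_{ℂ_F}` for every `t ∈ 𝔪_{ℂ_F}` — `[p]`-division towers exist above every point of `Ŵ(𝔪_{ℂ_F})` (the input `u` of
`AinfRamifiedDivisionLift` at ORDINARY reduction). [cite: SilvermanAEC2009, IV.4.4 and IV.7] [cite: LubinTate1965, §1] -/
theorem exists_evalPt₁_formalMul_prime_eq {A : Type*} [CommRing A] [UniformSpace A] [DiscreteUniformity A] [Algebra A (CBall F)]
    [ContinuousSMul A (CBall F)] (hpC : ‖(p : CompletedAlgClosure F)‖ < 1) (W : WeierstrassCurve A)
    (h1 : IsUnit (algebraMap A (CBall F) (PowerSeries.coeff p (W.formalMul p)))) (t : (maxNilIdealC F).toIdeal) :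
    ∃ s : (maxNilIdealC F).toIdeal, evalPt₁ (maxNilIdealC F) (W.formalMul p) (W.constantCoeff_formalMul p) s = t := by
  have h1' : IsUnit (PowerSeries.coeff p ((W.map (algebraMap A (CBall F))).formalMul p)) := by
    rw [← WeierstrassCurve.map_formalMul, PowerSeries.coeff_map]; exact h1
  obtain ⟨s, hs⟩ := exists_aeval_formalMul_prime_eq hpC (W.map (algebraMap A (CBall F))) h1' t
  refine ⟨s, Subtype.ext ?_⟩
  rw [← aeval_map_algebraMap_eq_evalPt₁, WeierstrassCurve.map_formalMul]
  exact hs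

end Literature.NumberTheory.PAdicHodge

end
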